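import Literature.NumberTheory.EllipticCurves.Kato2004.AdmissibleZetaClass
import Literature.NumberTheory.EllipticCurves.Kato2004.IwasawaH2FineSelmerDualComparison
import Literature.NumberTheory.EllipticCurves.KatoRankBoundProofs
import Literature.NumberTheory.EllipticCurves.GaloisAction
import HarnessLib

/-!
# Kato 2004 (Astérisque 295) Conj. 12.10 («main conjecture») AT THE HEIGHT-ONE PRIME `𝔭_T = (T)` for
# `T = T_pW` at a DOOR PRIME — a THEOREM there by Burungale–Castella–Skinner 2025 Thm. 1.1.2 (a)
# (cyclotomic IMC `ch_Λ X(E/ℚ_∞) = (L_p(E/ℚ))` in `Λ ⊗ ℚ_p`) and Kato §17.13 (the Coleman-map exact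
# sequence (17.13.1) and the length identity of p. 280), read on Kato's `𝐇²_Γ(T_pW)` TOGETHER WITH its
# Poitou–Tate embedding of the dual fine Selmer group ((14.9.1), the tree fact
# `exists_iwasawaH2Data_fineSelmerDual_embedding`, finiteness of `E(ℚ_{p,∞})[p^∞]` at good `p` by Imai
# 1975) and through ADMISSIBLE zeta classes (`Z(f,T)_{(T)} = Λ_{(T)}·z₀`) — ONE named fact

Topic `NumberTheory/EllipticCurves`, sub-directory `Kato2004` (namespace = path). Prover seat
`bsd-line-dkd-w2` (stub worker of crux `DerivedKatoDoor`, stmt-BirchSwinnertonDyer-23024, route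
`DerivedKatoValuationDoor`, line `lower`, stub `stub_quotientLengthLeFineLength` — «the Kato §17.13
translation, NOT in tree, to be stated as a Literature fact by w2», `Cruxes/DerivedKatoDoor/Lines/lower.md`).
HONEST FRAMING: ONE named fact (`def … : Prop`, D-0014; nothing asserted). It is a THEOREM of the sources
(BCS 2025 + Kato 2004 + Imai 1975), not a conjecture, at door primes; it is WEAKER than print (only the
prime `(T)`, only the `Δ`-trivial component, only `T_pW`). No `_holds` expected soon (size XL: Kato's Euler
system divisibility + the Skinner–Urban/Wan/BCS converse divisibility + Kato's §17.13 bookkeeping on the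
genuine `𝐇²`; of these the tree holds the §17.13 MODULE THEORY (`Kato2004.kato_divisibility_body_of_skeleton`,
`KatoDivisibilitySkeletonProofs`) and the BCS statement (`burungale_castella_skinner_charIdeal_eq_padicLFunction`)
but not the identification of an admissible class's `Λ`-line with the package's zeta module `Z` at `(T)`,
nor the change of topological generator for `IwasawaH1Data` / `FineSelmerDualData` — see DISCHARGE ROAD).
No `instance`, no notation, no `sorry`. BSD is not advanced by this file; its consumer is the Summits-side
`stub_quotientLengthLeFineLength` (crux 23024, line `lower`), which takes the `≤` half of the equality.

## The printed statements

* **Kato, Conj. 12.10 (main conjecture) [p. 224]**: «Let `T` be a `Gal(ℚ̄/ℚ)`-stable `O_λ`-lattice of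
  `V_{F_λ}(f)` and let `𝔭` be a prime ideal of `Λ` of height one. In the case `p = 2`, assume `𝔭` does not
  contain `2`. Then `Z(f,T)_𝔭 ⊂ 𝐇¹(T)_𝔭` and `length_{Λ_𝔭}(𝐇²(T)_𝔭) = length_{Λ_𝔭}(𝐇¹(T)_𝔭/Z(f,T)_𝔭)`.»
  Thm. 12.5 (4) [p. 222] proves `≤` (under (12.5.2) when `𝔭 ∋ p`; at `𝔭 = (T) ∌ p` unconditionally).
* **Kato, §17.13 [pp. 279–280]**: the exact sequence (17.13.1) and, at every height-one `𝔭` (for `𝔭 ∋ p`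
  under (12.5.2)), «`0 → 𝐇¹(T(k))_𝔭 → 𝐇¹_loc(T(k))_𝔭/𝐇¹_loc(T'(k))_𝔭 → 𝔛(T*(1−k))_𝔭 → 𝐇²(T(k))_𝔭 → 0` …
  By 17.11 and by 12.5, 16.6, we have an isomorphism `𝐇¹_loc(T(k))_𝔭/𝐇¹_loc(T'(k))_𝔭 ≅ Λ_𝔭` which sends the
  image of `Z(f,T)(k)_𝔭` onto `Λ_𝔭 · L_{p-adic,α,ω,γ}(f)`. Hence we obtain an exact sequence
  `0 → 𝐇¹(T(k))_𝔭/Z(f,T)(k)_𝔭 → Λ_𝔭/(Λ_𝔭·L_{p-adic,α,ω,γ}(f)) → 𝔛(T*(1−k))_𝔭 → 𝐇²(T(k))_𝔭 → 0`. Hence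
  `𝔛(T*(1−k))_𝔭` is a torsion `Λ_𝔭`-module, and `length(𝔛_𝔭) − length(Λ_𝔭/(L_{p-adic})) = length(𝐇²_𝔭) −
  length(𝐇¹_𝔭/Z(f,T)_𝔭)`» — so AT EACH `𝔭`, «`char 𝔛 = (L_p)` at `𝔭`» ⟺ «Conj. 12.10 at `𝔭`». For `E/ℚ`:
  `k = 2`, `T(k) ≅ T_pE(1)`, `𝔛(T*(1−k)) = X(E/ℚ_∞)` the Pontryagin dual of `Sel_{p^∞}(E/ℚ_∞)` (Kato 17.2–17.3),
  `Δ`-trivial components (READING of `Kato2004/DivisibilityInputs.lean`, module docstring).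
* **Burungale–Castella–Skinner 2025, Thm. 1.1.2 (a)** (IMRN 2025 = arXiv:2405.00270v2, p. 2): «Let `E` be
  an elliptic curve defined over `ℚ` and `p` a prime of good ordinary reduction for `E`. (a) If `p > 3`
  satisfies (irr_ℚ), then `X^ord(E/ℚ_∞)` is `Λ`-torsion, with `ch_Λ(X^ord(E/ℚ_∞)) = (L_p(E/ℚ))` in `Λ ⊗ ℚ_p`.»
  (tree: `burungale_castella_skinner_charIdeal_eq_padicLFunction`). An equality in `Λ ⊗ ℚ_p = Λ[1/p]`
  determines the lengths at every height-one `𝔭 ∌ p`, in particular at `𝔭_T = (T)`. At a DOOR PRIME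
  (`p ≥ 5` good ordinary, `ρ̄_{E,p}` onto ⇒ (irr_ℚ)) this gives, with the display above at `𝔭 = (T)`:
  **`length_{(T)} 𝐇²_Γ(T_pW) = length_{(T)} (𝐇¹_Γ(T_pW)/Z(f,T_pW))`** — Conj. 12.10 at `(T)`, PROVED.
* **Kato (14.9.1) [p. 239], (12.2.3) [p. 220], (17.13.1)** (the content of the tree's named fact
  `exists_iwasawaH2Data_fineSelmerDual_embedding`, module docstring of
  `Kato2004/IwasawaH2FineSelmerDualComparison.lean`): for `p` odd and `κ` cyclotomic, an exact sequence
  `0 → X₀(E/ℚ_∞) → 𝐇²_Γ(T_pW) → (W(ℚ_{p,∞})[p^∞])^∨`; and **Imai 1975, Theorem** (Proc. Japan Acad. 51,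
  p. 12): for an abelian variety with GOOD reduction over a `p`-adic field `k`, `A(k(μ_{p^∞}))_{tors}` is
  finite — so at a good (door) prime `W(ℚ_{p,∞})[p^∞]` is finite and `X₀ ↪ 𝐇²_Γ` has FINITE cokernel, whence
  `length_{(T)} X₀ = length_{(T)} 𝐇²_Γ` (`lengthAt_eq_of_injective_of_finite_quotient`).
* **Admissible classes** (tree `Kato2004/AdmissibleZetaClass.lean`, (A6′) and module docstring; Kato 13.9–13.12,
  Lemma 13.10 (1), Thm. 12.5 (1)): `{z₀ admissible} = Λˣ·𝐳_{γ_W} ∩ 𝐇¹_Γ`, `Z(f,T_pW)` has `Δ`-trivial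
  component `Λ·𝐳_{γ_W}`, and the multiplier `M̃` relating `z₀` to the Λ-adic lift of Kato's `(c,d)`-family has
  augmentation `≠ 0` (tree THEOREM `constantCoeff_katoMultiplier_ne_zero`), i.e. is a unit of `Λ_{(T)}`, as are
  `p`-powers: `Z(f,T)_{(T)} = Λ_{(T)}·z₀`, so `length_{(T)}(𝐇¹/Z(f,T)) = length_{(T)}(𝐇¹_Γ/Λ z₀)`.

HENCE (the typed statement): at a door prime, for every cyclotomic `κ = K`, topological generator `γ`, pinned
`I : IwasawaH1Data W p K γ`, there are Kato's `𝐇²_Γ(T_pW)` as a descent package `J : IwasawaH2Data W p K γ I`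
(pinned by (14.14.1) to `proj₀`, as in the sibling fact) and the Poitou–Tate embedding
`e : X₀(E/ℚ_∞) = (W.fineSelmerDualData K hγ).X ↪ J.H2` with finite cokernel, such that for EVERY admissible
`z₀ ∈ I.H`: `length_{(T)} J.H2 = length_{(T)} (I.H/Λz₀)`.

GENERATOR INDEPENDENCE. Kato's `Λ = ℤ_p[[G_∞]] ⊇ ℤ_p[[Γ]]` is intrinsic; the tree's `Λ = ℤ_p⟦T⟧` acts on
`I.H`, `J.H2`, `X₀` through `T = γ − 1` for the CHOSEN topological generator `γ`; another generator
`γ' = γ^u` changes the structure by the automorphism `T ↦ (1+T)^u − 1` of `ℤ_p⟦T⟧`, which fixes the prime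
`(T)` (Washington §13.2; tree `IwasawaGeneratorChangeProofs.lean` for `X(E/ℚ_∞)`), so lengths at `(T)` do
not depend on `γ` and the statement is made for every topological generator (BCS's `IsCyclotomicVariable`
normalisation is needed only to NAME the generator of `ch_Λ X` as `L_p(E,T)`; the length at `(T)` is
`ord_{T=0} L_p`, the same for every generator).

JUNK / COOKED-DATA AUDIT. `I` is pinned (layer projections jointly injective/surjective); `X₀` is
CONSTRUCTED; `z₀` ranges over admissible classes (pinned up to `Λˣ`; `Λ z₀` and hence the length are
insensitive); `J` and `e` are EXISTENTIAL — the fact says Kato's genuine `𝐇²_Γ` with its genuine Poitou–Tate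
embedding HAS the listed properties; a consumer may read off `J.H2` only what the clauses give (here: its
`(T)`-length equals both `length_{(T)} X₀` — by `e` — and `length_{(T)}(I.H/Λz₀)`). Not vacuous: admissible
classes exist at door primes (Kato Thm. 12.5 (4) under (12.5.2)) and `I`, `X₀` exist; not `⊥`: at the E-S0-1
cells (e.g. `389a1`, `p = 5`) both sides equal `1`.

DISCHARGE ROAD (what an in-tree proof would use; recorded for the debt queue). (i) tree facts
`burungale_castella_skinner_charIdeal_eq_padicLFunction` (BCS), `exists_divisibilityInputsZetaLine_fineQuotient_zeta`
/ `exists_divisibilityInputs_fineQuotient_zeta` (Kato's §17.13 package WITH the fine quotient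
`π : X ↠ X₀` exact after `P → X` and `Z ≤ span{IsEulerSystemClass}`), `exists_iwasawaH2Data_fineSelmerDual_embedding`;
(ii) kernel algebra already written for the sibling card (`ColemanStepDoorSketch.lean`, idea
`coleman-step-door-r2`: `order_eq_indices` `ord_T L_p = c + δ + e`, `ℓ_T(X) = c + ℓ_T(𝐇²)`); (iii) TWO missing
print links: (a) `Z_{(T)} ⊆ Λ_{(T)}·z₀`, i.e. `ℓ_T(I.H/Λz₀) ≤ ℓ_T(I.H/Z)`: Kato's `Z` is generated by the Λ-adic
lifts of HIS `(c,d)`-families (Thm. 12.6), each a `(Λ ⊗ ℚ)`-multiple `M·𝐳_{γ_W}` of Kato's element by a multiplier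
of non-zero augmentation (13.9–13.12, Lemma 13.10 (1); `constantCoeff_katoMultiplier_ne_zero` for the admissible
family) — this needs a span clause naming KATO's families (lifts of `ZetaBody` data); the tree's clause
`Z ≤ span{IsEulerSystemClass}` (arbitrary Euler systems) is too weak for it, since «every Euler-system class is
a `Λ_{(T)}`-multiple of `z₀`» is the primitivity of Kato's system at `(T)`, itself of main-conjecture strength
(Mazur–Rubin); (b) transport of `I`, `X₀`, `X` along a change of topological generator (BCS and the packages are
stated under `IsCyclotomicVariable p γ`).
-- TODO(general form): Conj. 12.10 at EVERY height-one `𝔭` (at `𝔭 ∋ p` from BCS Thm. 1.1.2 (b), the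
-- integral equality under `ρ_{E,p^∞}` onto, tree `burungale_castella_skinner_charIdeal_eq_padicLFunction_integral`),
-- for all `Δ`-components and general lattices `T ⊂ V_{F_λ}(f)`; here `(T)` only, `T_pW`, trivial component.

## References

* K. Kato, *p-adic Hodge theory and values of zeta functions of modular forms*, Astérisque 295 (2004):
  Conj. 12.10 (p. 224), Thm. 12.4–12.5 (pp. 221–222), 13.9–13.12 (pp. 229–231), (14.9.1) (p. 239),
  (14.14.1) (p. 243), 17.2–17.3, Prop. 17.11 (p. 277), §17.13 (pp. 279–280) — re-read 2026-08-28 from the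
  store text `paper:doi-10-24033-ast-639` (p0109, p0162, p0164–p0165). [Kato2004Asterisque]
* A. Burungale, F. Castella, C. Skinner, *Base change and Iwasawa main conjectures for GL₂*, IMRN 2025
  (arXiv:2405.00270v2), Thm. 1.1.2 (a) (p. 2). [BurungaleCastellaSkinner2025]
* H. Imai, *A remark on the rational points of abelian varieties with values in cyclotomic
  ℤ_p-extensions*, Proc. Japan Acad. 51 (1975) 12–16, Theorem. [Imai1975]
* L. Washington, *Introduction to Cyclotomic Fields*, GTM 83, §13.2. [Washington1997]
* Tree: `Kato2004/IwasawaH2FineSelmerDualComparison.lean` (`exists_iwasawaH2Data_fineSelmerDual_embedding`,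
  `lengthAt_eq_of_injective_of_finite_quotient`), `Kato2004/IwasawaH2Descent.lean` (`IwasawaH2Data`),
  `Kato2004/AdmissibleZetaClass.lean`, `KatoFineSelmerDualProofs.lean` (`WeierstrassCurve.fineSelmerDualData`),
  `CyclotomicIwasawaMainTheoremIrreducible.lean` (BCS), `Kato2004/DivisibilityInputs*.lean`,
  `KatoRankBoundProofs.lean` (`IwasawaAlgebra.primeT`), `IwasawaGeneratorChangeProofs.lean`.
-/

noncomputable section

open Field
open Literature.NumberTheory.GaloisRepresentations
open Literature.NumberTheory.EllipticCurves Literature.NumberTheory.EllipticCurves.Module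

namespace Literature.NumberTheory.EllipticCurves.Kato2004

/-- **Kato 2004 Conj. 12.10 at `𝔭 = (T)` for `T_pW` at a door prime — a THEOREM (Burungale–Castella–Skinner
2025 Thm. 1.1.2 (a) + Kato §17.13, p. 280) — on Kato's `𝐇²_Γ(T_pW)` with its Poitou–Tate embedding of the
dual fine Selmer group (Kato (14.9.1) + Imai 1975), through admissible zeta classes.** For every elliptic
`E/ℚ` with globally minimal model `W`, every DOOR PRIME `p` (`5 ≤ p`, good ordinary, `ρ̄_{E,p}` onto), the
cyclotomic `ℤ_p`-extension `K` with ANY topological generator `γ`, and every pinned Iwasawa cohomology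
`I : IwasawaH1Data W p K γ` (`𝐇¹_Γ(T_pW)`): there are a descent package `J : IwasawaH2Data W p K γ I`
(Kato's `𝐇²_Γ(T_pW)`, pinned by (14.14.1) to `proj₀`) and an injective `Λ`-linear map
`e : X₀(E/ℚ_∞) = (W.fineSelmerDualData K hγ).X → J.H2` with FINITE cokernel (the limit of (14.9.1);
`W(ℚ_{p,∞})[p^∞]` is finite at the good prime `p` by Imai) such that for EVERY admissible Kato zeta class
`z₀ ∈ I.H` (`IsAdmissibleZetaClass`, `Z(f,T)_{(T)} = Λ_{(T)} z₀`):
`length_{(T)} J.H2 = length_{(T)} (I.H ⧸ Λz₀)` — «`length_{Λ_𝔭}(𝐇²(T)_𝔭) = length_{Λ_𝔭}(𝐇¹(T)_𝔭/Z(f,T)_𝔭)`»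
at `𝔭 = (T)`, which by Kato's p. 280 identity `length(𝔛_𝔭) − length(Λ_𝔭/(L_p)) = length(𝐇²_𝔭) −
length(𝐇¹_𝔭/Z_𝔭)` is the `(T)`-part of BCS's `ch_Λ X(E/ℚ_∞) = (L_p)` in `Λ ⊗ ℚ_p`. Lengths at `(T)` do not
depend on the generator `γ` (`T ↦ (1+T)^u − 1` fixes `(T)`). READING, audit and discharge road in the module
docstring. Named fact; nothing asserted; weaker than print (only `𝔭 = (T)`); no `_holds` expected soon.
[cite: Kato2004Asterisque, Conj. 12.10 (p. 224), §17.13 (pp. 279–280), (14.9.1) (p. 239), (14.14.1) (p. 243)]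
[cite: BurungaleCastellaSkinner2025, Thm. 1.1.2 (a) (p. 2 of arXiv:2405.00270v2)]
[cite: Imai1975, Theorem (p. 12)] [cite: Washington1997, §13.2] -/
def kato_mainConjecture_primeT_of_door : Prop :=
  ∀ (W : WeierstrassCurve ℚ) [W.IsElliptic] [W.IsGloballyMinimal] (p : ℕ) [Fact p.Prime]
    [ContinuousSMul ℤ_[p] (W.tateModule p)],
    5 ≤ p → IsOrdinaryAt W p → W.HasSurjectiveModNGaloisRep p →
    ∀ (K : ZpExtension ℚ p) (hK : K.IsCyclotomic) (γ : absoluteGaloisGroup ℚ) (hγ : K.IsTopGenerator γ)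
      (I : IwasawaH1Data W p K γ),
      ∃ (J : IwasawaH2Data W p K γ I)
        (e : (W.fineSelmerDualData K hγ).X →ₗ[IwasawaAlgebra p] J.H2),
        Function.Injective e ∧ Finite (J.H2 ⧸ LinearMap.range e) ∧
        ∀ z₀ : I.H, IsAdmissibleZetaClass W p K hK I z₀ →
          lengthAt (IwasawaAlgebra p) J.H2 (IwasawaAlgebra.primeT p) =
            lengthAt (IwasawaAlgebra p)
              (I.H ⧸ Submodule.span (IwasawaAlgebra p) {z₀}) (IwasawaAlgebra.primeT p)

end Literature.NumberTheory.EllipticCurves.Kato2004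

end
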